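import Mathlib.Analysis.Calculus.InverseFunctionTheorem.FDeriv
import Mathlib.Analysis.Calculus.FDeriv.Prod
import HarnessLib

/-!
# The implicit-function step of (N1) «every inner orbit meets the slice», abstractly: a zero of `f(·, w, c)` with `‖e‖ ≤ K‖w‖` from a block-triangular strict derivative
# (lane A of S-BASE, crux `TwistedTraceScaling` stmt-QuantumFields-20203, C4 INNER; design note `pub/ym-fleet/ym-luscher-20007-p1/COARSE-DESIGN.md` §23.8 (N1)(c)–(d))

The concrete (N1) (§23.8) applies the inverse function theorem to `F(ξ, w, c) = (P_Γ Φ(ξ, w, c), w, c)` where `Φ(ξ,w,c) = relLinkVec((orthoTube P(c) w)^{P∘ξ})`, `ξ` mean-zero,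
`w` balanced, `c` the slow coordinate: `∂_ξ(P_ΓΦ)(0) = −sliceEquiv 1` is invertible (`…SliceEquiv`), `Φ(0, 0, c) = 0`.  THIS FILE is the abstract calculus step, once and for all:
★★ `exists_zero_near_of_hasStrictFDerivAt`: let `f : E × (W × C) → F` (`E, W, C` real Banach spaces) be strictly differentiable at `0` with derivative `(e, w, c) ↦ A e + B w`, `A : E ≃L F`,
and `f(0, 0, c) = 0` for `c` near `0`.  Then there are `K` and `ε > 0` such that for all `‖w‖, ‖c‖ < ε` some `e` with `‖e‖ ≤ K‖w‖` solves `f(e, w, c) = 0`.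
(Proof: `F̂(e, p) = (f(e,p), p)` has the block-triangular strict derivative `blockEquiv A B` — ★ an explicit `ContinuousLinearEquiv` — so Mathlib's `HasStrictFDerivAt.localInverse` inverts it
near `0`; the local inverse is Lipschitz near `0` (`HasStrictFDerivAt.exists_lipschitzOnWith`) and fixes the points `(0, 0, c)`.)  The bound `‖e‖ ≤ K‖w‖` (not `K‖P_Γ w‖`) is what (N2) needs
(§23.8: the slice point stays within `O(β^{-s})` of the tube point).
HONEST FRAMING: textbook calculus for a stub of a child of the CONDITIONAL reduction route R2b1; no spectral claim; C4 OPEN; not a gap, not Clay.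
-/

set_option autoImplicit false

noncomputable section

open Filter Topology Metric

namespace Summit.QuantumFields.YangMills.Theorems.FemtoTransferGap.TwoLattice.ConstTube

variable {E W C F : Type*} [NormedAddCommGroup E] [NormedSpace ℝ E] [NormedAddCommGroup W] [NormedSpace ℝ W]
  [NormedAddCommGroup C] [NormedSpace ℝ C] [NormedAddCommGroup F] [NormedSpace ℝ F]

/-! ## §1 The block-triangular equivalence -/

/-- The block-triangular map `(e, (w, c)) ↦ (A e + B w, (w, c))` as a continuous linear map. [folklore] -/
def blockMap (A : E →L[ℝ] F) (B : W →L[ℝ] F) : E × (W × C) →L[ℝ] F × (W × C) :=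
  (A.comp (ContinuousLinearMap.fst ℝ E (W × C)) + B.comp ((ContinuousLinearMap.fst ℝ W C).comp (ContinuousLinearMap.snd ℝ E (W × C)))).prod
    (ContinuousLinearMap.snd ℝ E (W × C))

/-- Its inverse `(y, (w, c)) ↦ (A⁻¹(y − B w), (w, c))`. [folklore] -/
def blockInv (A : E ≃L[ℝ] F) (B : W →L[ℝ] F) : F × (W × C) →L[ℝ] E × (W × C) :=
  ((A.symm : F →L[ℝ] E).comp (ContinuousLinearMap.fst ℝ F (W × C) - B.comp ((ContinuousLinearMap.fst ℝ W C).comp (ContinuousLinearMap.snd ℝ F (W × C))))).prod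
    (ContinuousLinearMap.snd ℝ F (W × C))

omit [NormedSpace ℝ C] in
/-- Components of `blockMap`. [folklore] -/
@[simp] theorem blockMap_apply [NormedSpace ℝ C] (A : E →L[ℝ] F) (B : W →L[ℝ] F) (x : E × (W × C)) :
    blockMap A B x = (A x.1 + B x.2.1, x.2) := rfl

omit [NormedSpace ℝ C] in
/-- Components of `blockInv`. [folklore] -/
@[simp] theorem blockInv_apply [NormedSpace ℝ C] (A : E ≃L[ℝ] F) (B : W →L[ℝ] F) (y : F × (W × C)) :
    blockInv A B y = (A.symm (y.1 - B y.2.1), y.2) := rfl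

/-- ★ **The block-triangular equivalence** `(e, (w, c)) ↦ (A e + B w, (w, c))` for `A : E ≃L F`. [folklore] -/
def blockEquiv (A : E ≃L[ℝ] F) (B : W →L[ℝ] F) : (E × (W × C)) ≃L[ℝ] (F × (W × C)) :=
  ContinuousLinearEquiv.equivOfInverse (blockMap (A : E →L[ℝ] F) B) (blockInv A B)
    (fun x => by simp)
    (fun y => by simp)

/-- The equivalence coerces to `blockMap`. [folklore] -/
theorem coe_blockEquiv (A : E ≃L[ℝ] F) (B : W →L[ℝ] F) : (blockEquiv (C := C) A B : E × (W × C) →L[ℝ] F × (W × C)) = blockMap (A : E →L[ℝ] F) B := rfl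

/-! ## §2 ★★ The implicit-function step -/

variable [CompleteSpace E] [CompleteSpace W] [CompleteSpace C]

/-- ★★ **A ZERO OF `f(·, w, c)` WITH `‖e‖ ≤ K‖w‖`** from a block-triangular strict derivative at `0` and `f(0, 0, c) = 0` near `c = 0`. [folklore] -/
theorem exists_zero_near_of_hasStrictFDerivAt (f : E × (W × C) → F) (A : E ≃L[ℝ] F) (B : W →L[ℝ] F)
    (hf : HasStrictFDerivAt f ((A : E →L[ℝ] F).comp (ContinuousLinearMap.fst ℝ E (W × C)) +
      B.comp ((ContinuousLinearMap.fst ℝ W C).comp (ContinuousLinearMap.snd ℝ E (W × C)))) (0, (0, 0)))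
    (h0 : ∀ᶠ c in 𝓝 (0 : C), f (0, (0, c)) = 0) :
    ∃ K ε : ℝ, 0 ≤ K ∧ 0 < ε ∧ ∀ (w : W) (c : C), ‖w‖ < ε → ‖c‖ < ε → ∃ e : E, f (e, (w, c)) = 0 ∧ ‖e‖ ≤ K * ‖w‖ := by
  -- the augmented map and its invertible strict derivative
  set Fh : E × (W × C) → F × (W × C) := fun x => (f x, x.2) with hFh
  have hFd : HasStrictFDerivAt Fh (blockEquiv (C := C) A B : E × (W × C) →L[ℝ] F × (W × C)) (0, (0, 0)) := by
    rw [coe_blockEquiv]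
    exact hf.prodMk hasStrictFDerivAt_snd
  have hf00 : f (0, (0, 0)) = 0 := h0.self_of_nhds
  have hFh0 : Fh (0, (0, 0)) = (0, (0, 0)) := by simp [hFh, hf00]
  -- the local inverse, its two-sided inverse properties near 0 and its Lipschitz bound
  set G := hFd.localInverse Fh _ _ with hG
  have hright : ∀ᶠ y in 𝓝 (0 : F × (W × C)), Fh (G y) = y := by
    have h := hFd.eventually_right_inverse; rwa [hFh0] at h
  have hleft : ∀ᶠ x in 𝓝 (0 : E × (W × C)), G (Fh x) = x := hFd.eventually_left_inverse
  obtain ⟨K, s, hs, hLip⟩ := (hFd.to_localInverse).exists_lipschitzOnWith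
  rw [hFh0] at hs
  -- a common radius
  obtain ⟨ε₁, hε₁, hball₁⟩ := Metric.mem_nhds_iff.mp (Filter.inter_mem hright hs)
  obtain ⟨ε₂, hε₂, hball₂⟩ := Metric.mem_nhds_iff.mp hleft
  obtain ⟨ε₃, hε₃, hball₃⟩ := Metric.mem_nhds_iff.mp h0
  refine ⟨K, min ε₁ (min ε₂ ε₃), K.2, lt_min hε₁ (lt_min hε₂ hε₃), fun w c hw hc => ?_⟩
  have hw1 : ‖w‖ < ε₁ := lt_of_lt_of_le hw (min_le_left _ _)
  have hc1 : ‖c‖ < ε₁ := lt_of_lt_of_le hc (min_le_left _ _)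
  have hc2 : ‖c‖ < ε₂ := lt_of_lt_of_le hc ((min_le_right _ _).trans (min_le_left _ _))
  have hc3 : ‖c‖ < ε₃ := lt_of_lt_of_le hc ((min_le_right _ _).trans (min_le_right _ _))
  -- the two points `y = (0, (w, c))`, `y₀ = (0, (0, c))`
  set y : F × (W × C) := (0, (w, c)) with hy
  set y₀ : F × (W × C) := (0, (0, c)) with hy₀
  have hy_mem : y ∈ ball (0 : F × (W × C)) ε₁ := by
    rw [mem_ball, dist_zero_right, hy, Prod.norm_def, Prod.norm_def]; simp [hw1, hc1]
  have hy₀_mem : y₀ ∈ ball (0 : F × (W × C)) ε₁ := by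
    rw [mem_ball, dist_zero_right, hy₀, Prod.norm_def, Prod.norm_def]; simp [hc1]
  have hx₀_mem : ((0 : E), ((0 : W), c)) ∈ ball (0 : E × (W × C)) ε₂ := by
    rw [mem_ball, dist_zero_right, Prod.norm_def, Prod.norm_def]; simp [hc2]
  have hc_mem : c ∈ ball (0 : C) ε₃ := by rw [mem_ball, dist_zero_right]; exact hc3
  -- `F̂ (G y) = y`: the first component of `G y` is a zero of `f(·, w, c)`
  have hGy : Fh (G y) = y := (hball₁ hy_mem).1
  have hGy2 : (G y).2 = (w, c) := by
    have := congrArg Prod.snd hGy; simpa [hFh, hy] using this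
  have hzero : f (G y) = 0 := by
    have := congrArg Prod.fst hGy; simpa [hFh, hy] using this
  -- `G y₀ = (0, (0, c))` (left inverse at the fixed point)
  have hf0c : f (0, (0, c)) = 0 := hball₃ hc_mem
  have hFx₀ : Fh (0, (0, c)) = y₀ := by simp [hFh, hy₀, hf0c]
  have hGy₀ : G y₀ = (0, (0, c)) := by rw [← hFx₀]; exact hball₂ hx₀_mem
  -- Lipschitz bound
  have hdist : dist (G y) (G y₀) ≤ K * dist y y₀ := hLip.dist_le_mul y (hball₁ hy_mem).2 y₀ (hball₁ hy₀_mem).2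
  have hyy₀ : dist y y₀ = ‖w‖ := by
    rw [dist_eq_norm, hy, hy₀, Prod.mk_sub_mk, Prod.mk_sub_mk, sub_zero, sub_zero, sub_self, Prod.norm_def, Prod.norm_def]
    simp
  refine ⟨(G y).1, ?_, ?_⟩
  · have : G y = ((G y).1, (w, c)) := by rw [← hGy2]
    rw [this] at hzero; exact hzero
  · calc ‖(G y).1‖ = ‖(G y - G y₀).1‖ := by rw [hGy₀, Prod.fst_sub, sub_zero]
      _ ≤ ‖G y - G y₀‖ := norm_fst_le _
      _ = dist (G y) (G y₀) := (dist_eq_norm _ _).symm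
      _ ≤ K * dist y y₀ := hdist
      _ = K * ‖w‖ := by rw [hyy₀]

end Summit.QuantumFields.YangMills.Theorems.FemtoTransferGap.TwoLattice.ConstTube

end
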